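import Mathlib
import Summits.NavierStokesRegularity.NavierStokesRegularity.Theorems.LerayQuarterDissipationFiniteDissipationLiouvilleVorticityLThreeTools
import HarnessLib

/-!
# Crux `FiniteDissipationLiouville` (stmt-NavierStokesRegularity-22144): the stretching term of
# the localised similarity-enstrophy budget priced by the `L³`-VORTICITY parameter — file 2/3

Theorems file of route `LerayQuarterDissipation` (lead prover g16; `--supports` the crux; tool for
`…VorticityLThree`). Navier–Stokes regularity is NOT proved by anything here; no summit is.
`U = lerayOrbit V`, `Ω = lerayVorticity V = curl U`, `φ_R(y) = smoothTransition(2 − ‖y‖²/R²)`,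
`Z_∞(s) = ∫‖Ω(s)‖²`, `KS = SNormLESNormFDerivOfEqConst ℝ³ volume 2` (Mathlib's
Gagliardo–Nirenberg–Sobolev constant, `‖g‖_{L⁶} ≤ KS‖Dg‖_{L²}`). The tree prices the stretching
term by `‖U‖ ≤ C` (T31⁗), by the `L²`-mass of `Ω` with Ladyzhenskaya (`…SmallDissipationGap*`) and
by `‖Ω‖ ≤ C_ω` (`…VorticityAmplitude`); here the intermediate `L² × L³ × L⁶` pricing:
* `sq_inner_fderiv_apply_le`, `inner_fderiv_apply_le_sqrt_mul` — trace-free kinematics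
  `⟪DUΩ,Ω⟫ ≤ σ‖Ω‖²`, `σ = √((2|DU|²_F − ‖curl U‖²)/3)` (`div U = 0`);
* **`two_mul_integral_sqCutoff_stretching_le_cubic`** — if `∫‖Ω(s)‖³ ≤ v³` then for `R ≥ 1`,
  `δ > 0`: `2∫φ_R²⟪DUΩ,Ω⟫ ≤ 2∫φ_R²|∇Ω|²_F + 0·Z_R + ((1+δ)KS²v²/6)Z_∞ + ((2c₁²/δ)/R)∫_{B̄_{2R}}‖Ω‖²`
  (Cauchy–Schwarz; `∫φ²σ² ≤ Z_∞/3` — half of the Dirichlet integral of a divergence-free `L⁶`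
  field is strain; Hölder `(3/2,3)`: `∫φ²‖Ω‖⁴ ≤ ‖Ω‖₃²‖φΩ‖₆²`; Sobolev; product rule with a free
  weight; AM–GM with the weight that makes the dissipation cancel exactly).
HONEST FRAMING. One estimate about a HYPOTHETICAL class with Mathlib's (non-sharp) Sobolev
constant; nothing here bears on Navier–Stokes regularity or blow-up; nothing is removed from the
catalogued DSS wall. References: Majda–Bertozzi 2002 §1.2; Evans 2010 §5.6.1; folklore energy method.
-/

noncomputable section

set_option linter.dupNamespace false

namespace Summit.NavierStokesRegularity.NavierStokesRegularity.Theorems.FiniteDissipationLiouville.VorticityLThree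

open MeasureTheory Set Filter Topology Metric InnerProductSpace Function Real
open scoped RealInnerProductSpace ContDiff ENNReal Laplacian
open Literature.Analysis Literature.Analysis.FluidPDE
open Summit.NavierStokesRegularity.NavierStokesRegularity.Theorems
open Summit.NavierStokesRegularity.NavierStokesRegularity.Theorems.GaussianGap
open Summit.NavierStokesRegularity.NavierStokesRegularity.Theorems.SimilarityEnstrophy
open Summit.NavierStokesRegularity.NavierStokesRegularity.Theorems.SmallDissipationGap
open Summit.NavierStokesRegularity.NavierStokesRegularity.Theorems.FiniteDissipationLiouville.VorticityAmplitude

variable {C : ℝ} {V : ℝ → (EuclideanSpace ℝ (Fin 3)) → (EuclideanSpace ℝ (Fin 3))}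



/-! ### The stretching term priced by the `L³` norm of the vorticity -/

section Stretching

set_option maxHeartbeats 400000 in
/-- **The stretching term against the squared cutoff, priced by `‖Ω(s)‖_{L³}`.** For
`V ∈ 𝒟_{C,K}`, a similarity time `s` with `‖Ω(s)‖³ ∈ L¹`, `∫‖Ω(s)‖³ ≤ v³` (`v ≥ 0`), `R ≥ 1`, `δ > 0`:
`2∫φ_R²⟪DUΩ,Ω⟫ ≤ 2∫φ_R²|∇Ω|²_F + 0·Z_R + ((1+δ)KS²v²/6)∫‖Ω(s)‖² + ((2c₁²/δ)/R)∫_{B̄_{2R}}‖Ω‖²`, the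
four-term shape of `integral_sq_norm_lerayVorticity_le_of_forall_one_le` (pointwise kinematics,
Cauchy–Schwarz, `∫φ²σ² ≤ Z_∞/3`, Hölder `(3/2,3)`, Sobolev, weighted product rule, AM–GM
`two_mul_le_add_of_le_sqrt_mul_sqrt` with `η = 2/(1+δ)`). [folklore energy method; Gagliardo–Nirenberg–Sobolev] -/
theorem two_mul_integral_sqCutoff_stretching_le_cubic (hV : IsTypeIAncientMild C V) {K : ℝ}
    (hK : ∀ t : ℝ, t < 0 → ∫⁻ x, ‖fderiv ℝ (V t) x‖ₑ ^ 2 ≤ ENNReal.ofReal (K / Real.sqrt (-t)))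
    {c₁ : ℝ}
    (hc₁ : ∀ R : ℝ, 0 < R → ∀ y : (EuclideanSpace ℝ (Fin 3)),
      ‖fderiv ℝ (fun z : (EuclideanSpace ℝ (Fin 3)) => smoothTransition (2 - ‖z‖ ^ 2 / R ^ 2)) y‖ ≤ c₁ / R)
    {R : ℝ} (hR1 : 1 ≤ R) (s : ℝ) {v : ℝ} (hv : 0 ≤ v)
    (hint3 : Integrable (fun y => ‖lerayVorticity V s y‖ ^ 3))
    (hv3 : ∫ y, ‖lerayVorticity V s y‖ ^ 3 ≤ v ^ 3) {δ : ℝ} (hδ : 0 < δ) :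
    2 * (∫ y, smoothTransition (2 - ‖y‖ ^ 2 / R ^ 2) ^ 2 *
        ⟪fderiv ℝ (lerayOrbit V s) y (lerayVorticity V s y), lerayVorticity V s y⟫) ≤
      2 * (∫ y, smoothTransition (2 - ‖y‖ ^ 2 / R ^ 2) ^ 2 *
          frobeniusNormSq (fderiv ℝ (lerayVorticity V s) y)) +
        0 * (∫ y, smoothTransition (2 - ‖y‖ ^ 2 / R ^ 2) ^ 2 * ‖lerayVorticity V s y‖ ^ 2) +
        ((1 + δ) * (SNormLESNormFDerivOfEqConst (EuclideanSpace ℝ (Fin 3))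
            (volume : Measure (EuclideanSpace ℝ (Fin 3))) 2 : ℝ) ^ 2 * v ^ 2 / 6) *
          (∫ y, ‖lerayVorticity V s y‖ ^ 2) +
        (2 * c₁ ^ 2 / δ) / R *
          ∫ y in closedBall (0 : EuclideanSpace ℝ (Fin 3)) (2 * R), ‖lerayVorticity V s y‖ ^ 2 := by
  have hR : 0 < R := lt_of_lt_of_le one_pos hR1
  set KS : ℝ := (SNormLESNormFDerivOfEqConst (EuclideanSpace ℝ (Fin 3))
    (volume : Measure (EuclideanSpace ℝ (Fin 3))) 2 : ℝ) with hKSdef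
  have hKS0 : 0 ≤ KS := NNReal.coe_nonneg _
  set φ : (EuclideanSpace ℝ (Fin 3)) → ℝ := fun z => smoothTransition (2 - ‖z‖ ^ 2 / R ^ 2) with hφdef
  set Ω := lerayVorticity V s with hΩdef
  set U := lerayOrbit V s with hUdef
  have hφ1 : ContDiff ℝ 1 φ := contDiff_smoothTransition_cutoff (n := 1) R
  have hφ0 : ∀ y, 0 ≤ φ y := fun y => smoothTransition_cutoff_nonneg R y
  have hφle : ∀ y, φ y ≤ 1 := fun y => smoothTransition.le_one _
  have hφz : ∀ y ∉ closedBall (0 : (EuclideanSpace ℝ (Fin 3))) (2 * R), φ y = 0 := fun y hy =>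
    smoothTransition_cutoff_eq_zero_of_notMem hR hy
  have hφ2c : HasCompactSupport fun y : (EuclideanSpace ℝ (Fin 3)) => φ y ^ 2 := hasCompactSupport_sqCutoff hR
  have hΩ1 : ContDiff ℝ 1 Ω := signedBudget_contDiff_lerayVorticity_slice hV s (n := 1)
  have hU1 : ContDiff ℝ 1 U := mustSqueeze_contDiff_lerayOrbit_slice hV s (n := 1)
  have hcΩ : Continuous Ω := hΩ1.continuous
  have hcDΩ : Continuous (fderiv ℝ Ω) := hΩ1.continuous_fderiv one_ne_zero
  have hcDU : Continuous (fderiv ℝ U) := hU1.continuous_fderiv one_ne_zero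
  have hcφ : Continuous φ := hφ1.continuous
  have hcDφ : Continuous (fderiv ℝ φ) := hφ1.continuous_fderiv one_ne_zero
  have hcF : Continuous fun y => frobeniusNormSq (fderiv ℝ Ω y) :=
    continuous_frobeniusNormSq_fderiv_lerayVorticity hV s
  have hcFU : Continuous fun y => frobeniusNormSq (fderiv ℝ U y) := by
    have hc : Continuous fun L : (EuclideanSpace ℝ (Fin 3)) →L[ℝ] (EuclideanSpace ℝ (Fin 3)) =>
        frobeniusNormSq L := by
      unfold frobeniusNormSq
      exact continuous_finsetSum _ fun i _ =>
        ((ContinuousLinearMap.apply ℝ (EuclideanSpace ℝ (Fin 3))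
          (stdOrthonormalBasis ℝ (EuclideanSpace ℝ (Fin 3)) i)).continuous.norm.pow 2)
    exact hc.comp hcDU
  have hdiv : VectorCalculus.IsDivFree U :=
    (isDivFree_lerayOrbit_iff V s).2 (hV.isDivFree (neg_neg_of_pos (Real.exp_pos _)))
  have hcurl : ∀ y, curl U y = Ω y := fun y => rfl
  obtain ⟨hintDU, -⟩ := integrable_sq_norm_fderiv_lerayOrbit hV hK s
  obtain ⟨hintΩ, -⟩ := integrable_sq_norm_lerayVorticity hV hK s
  have hF := integral_frobeniusNormSq_fderiv_lerayOrbit_eq hV hK s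
  rw [← hUdef] at hintDU hF
  rw [← hΩdef] at hintΩ hF
  have add_sq : ∀ p q : ℝ, (p + q) ^ 2 ≤ (1 + δ) * p ^ 2 + (1 + δ⁻¹) * q ^ 2 := fun p q => by
    have h : (1 + δ) * p ^ 2 + (1 + δ⁻¹) * q ^ 2 - (p + q) ^ 2 = (δ * p - q) ^ 2 / δ := by
      field_simp
      ring
    have h0 : 0 ≤ (δ * p - q) ^ 2 / δ := div_nonneg (sq_nonneg _) hδ.le
    linarith
  have hcs : ∀ {f : (EuclideanSpace ℝ (Fin 3)) → ℝ},
      (∀ y ∉ closedBall (0 : (EuclideanSpace ℝ (Fin 3))) (2 * R), f y = 0) → HasCompactSupport f :=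
    fun hf => HasCompactSupport.intro (isCompact_closedBall (0 : (EuclideanSpace ℝ (Fin 3))) (2 * R)) hf
  -- the test field `g = φ Ω`
  have hg1 : ContDiff ℝ 1 fun y => φ y • Ω y := hφ1.smul hΩ1
  have hcg : Continuous fun y => φ y • Ω y := hg1.continuous
  have hcDg : Continuous (fderiv ℝ fun y => φ y • Ω y) := hg1.continuous_fderiv one_ne_zero
  have hg0 : ∀ y ∉ closedBall (0 : (EuclideanSpace ℝ (Fin 3))) (2 * R), φ y • Ω y = 0 := fun y hy => by
    rw [hφz y hy, zero_smul]
  have hgts : tsupport (fun y => φ y • Ω y) ⊆ closedBall (0 : (EuclideanSpace ℝ (Fin 3))) (2 * R) :=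
    closure_minimal (fun y hy => by by_contra h; exact hy (hg0 y h)) isClosed_closedBall
  have hDg0 : ∀ y ∉ closedBall (0 : (EuclideanSpace ℝ (Fin 3))) (2 * R),
      fderiv ℝ (fun y => φ y • Ω y) y = 0 := fun y hy =>
    fderiv_of_notMem_tsupport ℝ fun h => hy (hgts h)
  have hsn : ∀ n : ℕ, n ≠ 0 → HasCompactSupport fun y => ‖φ y • Ω y‖ ^ n := fun n hn =>
    hcs fun y hy => by show ‖φ y • Ω y‖ ^ n = 0; rw [hg0 y hy, norm_zero, zero_pow hn]
  have hi2 : Integrable fun y => ‖φ y • Ω y‖ ^ 2 :=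
    (hcg.norm.pow 2).integrable_of_hasCompactSupport (hsn 2 two_ne_zero)
  have hi6 : Integrable fun y => ‖φ y • Ω y‖ ^ 6 :=
    (hcg.norm.pow 6).integrable_of_hasCompactSupport (hsn 6 (by norm_num))
  have hiB : Integrable fun y => ‖fderiv ℝ (fun y => φ y • Ω y) y‖ ^ 2 :=
    (hcDg.norm.pow 2).integrable_of_hasCompactSupport
      (hcs fun y hy => by show ‖fderiv ℝ (fun y => φ y • Ω y) y‖ ^ 2 = 0; rw [hDg0 y hy]; simp)
  set σ : (EuclideanSpace ℝ (Fin 3)) → ℝ := fun y =>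
    Real.sqrt ((2 * frobeniusNormSq (fderiv ℝ U y) - ‖Ω y‖ ^ 2) / 3) with hσdef
  set Sint : ℝ := ∫ y, φ y ^ 2 * ⟪fderiv ℝ U y (Ω y), Ω y⟫ with hSdef
  set P : ℝ := ∫ y, (φ y * σ y) ^ 2 with hPdef
  set Q : ℝ := ∫ y, (φ y * ‖Ω y‖ ^ 2) ^ 2 with hQdef
  set Zinf : ℝ := ∫ y, ‖Ω y‖ ^ 2 with hZinfdef
  set B : ℝ := ∫ y, ‖fderiv ℝ (fun y => φ y • Ω y) y‖ ^ 2 with hBdef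
  set D : ℝ := ∫ y, φ y ^ 2 * frobeniusNormSq (fderiv ℝ Ω y) with hDdef
  set I : ℝ := ∫ y in closedBall (0 : (EuclideanSpace ℝ (Fin 3))) (2 * R), ‖Ω y‖ ^ 2 with hIdef
  set S6 : ℝ := ∫ y, ‖φ y • Ω y‖ ^ 6 with hS6def
  set T3 : ℝ := ∫ y, ‖Ω y‖ ^ 3 with hT3def
  have hB0 : 0 ≤ B := integral_nonneg fun y => by positivity
  have hI0 : 0 ≤ I := integral_nonneg fun y => by positivity
  have hD0 : 0 ≤ D := integral_nonneg fun y => mul_nonneg (sq_nonneg _) (frobeniusNormSq_nonneg _)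
  have hZ0 : 0 ≤ Zinf := integral_nonneg fun y => by positivity
  have hS60 : 0 ≤ S6 := integral_nonneg fun y => by positivity
  have hT30 : 0 ≤ T3 := integral_nonneg fun y => by positivity
  have hσ0 : ∀ y, 0 ≤ σ y := fun y => Real.sqrt_nonneg _
  have hX0 : ∀ y, 0 ≤ (2 * frobeniusNormSq (fderiv ℝ U y) - ‖Ω y‖ ^ 2) / 3 := fun y => by
    rw [← hcurl y, curl_eq_curlCLM]
    exact div_nonneg (two_mul_frobeniusNormSq_sub_nonneg _) (by norm_num)
  have hcσ : Continuous σ := (((hcFU.const_mul 2).sub (hcΩ.norm.pow 2)).div_const 3).sqrt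
  -- (1) pointwise and Cauchy–Schwarz: `Sint ≤ √P √Q`
  have hpt : ∀ y, φ y ^ 2 * ⟪fderiv ℝ U y (Ω y), Ω y⟫ ≤ (φ y * σ y) * (φ y * ‖Ω y‖ ^ 2) := by
    intro y
    have h := inner_fderiv_apply_le_sqrt_mul (hdiv y) (Ω y)
    rw [hcurl y] at h
    have := mul_le_mul_of_nonneg_left h (sq_nonneg (φ y))
    calc φ y ^ 2 * ⟪fderiv ℝ U y (Ω y), Ω y⟫ ≤ φ y ^ 2 * (σ y * ‖Ω y‖ ^ 2) := this
      _ = (φ y * σ y) * (φ y * ‖Ω y‖ ^ 2) := by ring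
  have hsf : HasCompactSupport fun y => φ y * σ y :=
    hcs fun y hy => by show φ y * σ y = 0; rw [hφz y hy, zero_mul]
  have hsg : HasCompactSupport fun y => φ y * ‖Ω y‖ ^ 2 :=
    hcs fun y hy => by show φ y * ‖Ω y‖ ^ 2 = 0; rw [hφz y hy, zero_mul]
  have hmf : MemLp (fun y => φ y * σ y) (ENNReal.ofReal 2) volume := by
    rw [ENNReal.ofReal_ofNat]
    exact (hcφ.mul hcσ).memLp_of_hasCompactSupport hsf
  have hmg : MemLp (fun y => φ y * ‖Ω y‖ ^ 2) (ENNReal.ofReal 2) volume := by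
    rw [ENNReal.ofReal_ofNat]
    exact (hcφ.mul (hcΩ.norm.pow 2)).memLp_of_hasCompactSupport hsg
  have iS : Integrable fun y => φ y ^ 2 * ⟪fderiv ℝ U y (Ω y), Ω y⟫ :=
    ((hcφ.pow 2).mul ((hcDU.clm_apply hcΩ).inner hcΩ)).integrable_of_hasCompactSupport hφ2c.mul_right
  have iFG : Integrable fun y => (φ y * σ y) * (φ y * ‖Ω y‖ ^ 2) :=
    ((hcφ.mul hcσ).mul (hcφ.mul (hcΩ.norm.pow 2))).integrable_of_hasCompactSupport hsf.mul_right
  have hCS : Sint ≤ Real.sqrt P * Real.sqrt Q := by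
    have h := integral_mul_le_Lp_mul_Lq_of_nonneg Real.HolderConjugate.two_two
      (Eventually.of_forall fun y => mul_nonneg (hφ0 y) (hσ0 y))
      (Eventually.of_forall fun y => mul_nonneg (hφ0 y) (sq_nonneg _)) hmf hmg
    have e1 : ∫ y, (φ y * σ y) ^ (2 : ℝ) = P := integral_congr_ae (Eventually.of_forall fun y => by
      show (φ y * σ y) ^ (2 : ℝ) = (φ y * σ y) ^ 2
      rw [Real.rpow_two])
    have e2 : ∫ y, (φ y * ‖Ω y‖ ^ 2) ^ (2 : ℝ) = Q := integral_congr_ae (Eventually.of_forall fun y => by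
      show (φ y * ‖Ω y‖ ^ 2) ^ (2 : ℝ) = (φ y * ‖Ω y‖ ^ 2) ^ 2
      rw [Real.rpow_two])
    rw [e1, e2, ← Real.sqrt_eq_rpow, ← Real.sqrt_eq_rpow] at h
    exact (integral_mono iS iFG hpt).trans h
  -- (2) `0 ≤ P ≤ Z_∞/3`
  have hP0 : 0 ≤ P := integral_nonneg fun y => sq_nonneg _
  have iFU : Integrable fun y => frobeniusNormSq (fderiv ℝ U y) := integrable_frobeniusNormSq_fderiv hU1 hintDU
  have iX : Integrable fun y => (2 * frobeniusNormSq (fderiv ℝ U y) - ‖Ω y‖ ^ 2) / 3 :=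
    ((iFU.const_mul 2).sub hintΩ).div_const 3
  have hPle : P ≤ Zinf / 3 := by
    have hpt' : ∀ y, (φ y * σ y) ^ 2 ≤ (2 * frobeniusNormSq (fderiv ℝ U y) - ‖Ω y‖ ^ 2) / 3 := by
      intro y
      rw [mul_pow, hσdef, Real.sq_sqrt (hX0 y)]
      have h1 : φ y ^ 2 ≤ 1 := by
        have := hφle y; have := hφ0 y; nlinarith
      calc φ y ^ 2 * ((2 * frobeniusNormSq (fderiv ℝ U y) - ‖Ω y‖ ^ 2) / 3)
          ≤ 1 * ((2 * frobeniusNormSq (fderiv ℝ U y) - ‖Ω y‖ ^ 2) / 3) :=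
            mul_le_mul_of_nonneg_right h1 (hX0 y)
        _ = _ := one_mul _
    have iP : Integrable fun y => (φ y * σ y) ^ 2 :=
      ((hcφ.mul hcσ).pow 2).integrable_of_hasCompactSupport
        (hcs fun y hy => by show (φ y * σ y) ^ 2 = 0; rw [hφz y hy, zero_mul, sq, zero_mul])
    calc P ≤ ∫ y, (2 * frobeniusNormSq (fderiv ℝ U y) - ‖Ω y‖ ^ 2) / 3 := integral_mono iP iX hpt'
      _ = (2 * (∫ y, frobeniusNormSq (fderiv ℝ U y)) - Zinf) / 3 := by
          rw [integral_div, integral_sub (iFU.const_mul 2) hintΩ, integral_const_mul]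
      _ = Zinf / 3 := by rw [hF]; ring
  -- (3) Hölder `(3/2, 3)`: `Q ≤ T3^{2/3} S6^{1/3}`
  have h32 : (3 / 2 : ℝ).HolderConjugate 3 := Real.holderConjugate_iff.2 ⟨by norm_num, by norm_num⟩
  have hmf3 : MemLp (fun y => ‖Ω y‖ ^ 2) (ENNReal.ofReal (3 / 2)) volume := by
    have hae : AEStronglyMeasurable (fun y => ‖Ω y‖ ^ 2) volume :=
      (hcΩ.norm.pow 2).aestronglyMeasurable
    refine (integrable_norm_rpow_iff hae (by norm_num) (by simp)).1 ?_
    refine hint3.congr (Eventually.of_forall fun y => ?_)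
    show ‖Ω y‖ ^ 3 = ‖‖Ω y‖ ^ 2‖ ^ (ENNReal.ofReal (3 / 2)).toReal
    rw [ENNReal.toReal_ofReal (by norm_num : (0:ℝ) ≤ 3 / 2), Real.norm_of_nonneg (sq_nonneg _),
      ← Real.rpow_natCast ‖Ω y‖ 2, ← Real.rpow_mul (norm_nonneg _)]
    norm_num
  have hmg3 : MemLp (fun y => φ y ^ 2 * ‖Ω y‖ ^ 2) (ENNReal.ofReal 3) volume := by
    rw [show ENNReal.ofReal 3 = (3 : ℝ≥0∞) by norm_num]
    exact ((hcφ.pow 2).mul (hcΩ.norm.pow 2)).memLp_of_hasCompactSupport (hφ2c.mul_right)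
  have hQeq : Q = ∫ y, ‖Ω y‖ ^ 2 * (φ y ^ 2 * ‖Ω y‖ ^ 2) :=
    integral_congr_ae (Eventually.of_forall fun y => by
      show (φ y * ‖Ω y‖ ^ 2) ^ 2 = ‖Ω y‖ ^ 2 * (φ y ^ 2 * ‖Ω y‖ ^ 2); ring)
  have hHolder : Q ≤ T3 ^ (1 / (3 / 2 : ℝ)) * S6 ^ (1 / (3 : ℝ)) := by
    have h := integral_mul_le_Lp_mul_Lq_of_nonneg h32
      (Eventually.of_forall fun y => sq_nonneg ‖Ω y‖)
      (Eventually.of_forall fun y => mul_nonneg (sq_nonneg (φ y)) (sq_nonneg ‖Ω y‖)) hmf3 hmg3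
    have e1 : ∫ y, (‖Ω y‖ ^ 2) ^ (3 / 2 : ℝ) = T3 := integral_congr_ae (Eventually.of_forall fun y => by
      show (‖Ω y‖ ^ 2) ^ (3 / 2 : ℝ) = ‖Ω y‖ ^ 3
      rw [← Real.rpow_natCast ‖Ω y‖ 2, ← Real.rpow_mul (norm_nonneg _)]
      norm_num)
    have e2 : ∫ y, (φ y ^ 2 * ‖Ω y‖ ^ 2) ^ (3 : ℝ) = S6 := integral_congr_ae (Eventually.of_forall fun y => by
      show (φ y ^ 2 * ‖Ω y‖ ^ 2) ^ (3 : ℝ) = ‖φ y • Ω y‖ ^ 6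
      rw [show (3 : ℝ) = ((3 : ℕ) : ℝ) by norm_num, Real.rpow_natCast, norm_smul,
        Real.norm_of_nonneg (hφ0 y)]
      ring)
    rw [e1, e2] at h
    rwa [hQeq]
  -- (4) the two factors: `T3^{2/3} ≤ v²`, `S6^{1/3} ≤ KS² B`
  have hT : T3 ^ (1 / (3 / 2 : ℝ)) ≤ v ^ 2 := by
    have h1 : T3 ^ (1 / (3 / 2 : ℝ)) ≤ (v ^ 3) ^ (1 / (3 / 2 : ℝ)) :=
      Real.rpow_le_rpow hT30 hv3 (by norm_num)
    have e : (v ^ 3) ^ (1 / (3 / 2 : ℝ)) = v ^ 2 := by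
      rw [← Real.rpow_natCast v 3, ← Real.rpow_mul hv, ← Real.rpow_natCast v 2]
      norm_num
    rwa [e] at h1
  have hSob : S6 ≤ (KS * Real.sqrt B) ^ 6 := by
    have h := integral_norm_pow_six_le_of_integrable (volume : Measure (EuclideanSpace ℝ (Fin 3)))
      finrank_euclideanSpace_fin hg1 hi2 hi6 hiB
    rw [← hKSdef] at h
    exact h
  have hKB0 : 0 ≤ KS * Real.sqrt B := mul_nonneg hKS0 (Real.sqrt_nonneg _)
  have hS : S6 ^ (1 / (3 : ℝ)) ≤ KS ^ 2 * B := by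
    have h1 : S6 ^ (1 / (3 : ℝ)) ≤ ((KS * Real.sqrt B) ^ 6) ^ (1 / (3 : ℝ)) :=
      Real.rpow_le_rpow hS60 hSob (by norm_num)
    have e : ((KS * Real.sqrt B) ^ 6) ^ (1 / (3 : ℝ)) = KS ^ 2 * B := by
      rw [← Real.rpow_natCast (KS * Real.sqrt B) 6, ← Real.rpow_mul hKB0,
        show ((6 : ℕ) : ℝ) * (1 / 3) = ((2 : ℕ) : ℝ) by norm_num, Real.rpow_natCast, mul_pow,
        Real.sq_sqrt hB0]
    rwa [e] at h1
  have hQle : Q ≤ (v ^ 2 * KS ^ 2) * B := by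
    calc Q ≤ T3 ^ (1 / (3 / 2 : ℝ)) * S6 ^ (1 / (3 : ℝ)) := hHolder
      _ ≤ v ^ 2 * (KS ^ 2 * B) :=
          mul_le_mul hT hS (Real.rpow_nonneg hS60 _) (sq_nonneg _)
      _ = (v ^ 2 * KS ^ 2) * B := by ring
  -- (5) `B ≤ (1+δ) D + (1+δ⁻¹)(c₁/R)² I`
  have hDg : ∀ y, ‖fderiv ℝ (fun y => φ y • Ω y) y‖ ^ 2 ≤ (1 + δ) * (φ y ^ 2 * frobeniusNormSq (fderiv ℝ Ω y)) +
      (1 + δ⁻¹) * (‖fderiv ℝ φ y‖ ^ 2 * ‖Ω y‖ ^ 2) := by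
    intro y
    have hdφ : DifferentiableAt ℝ φ y := hφ1.differentiable one_ne_zero y
    have hdΩ : DifferentiableAt ℝ Ω y := hΩ1.differentiable one_ne_zero y
    have e : fderiv ℝ (fun y => φ y • Ω y) y = φ y • fderiv ℝ Ω y + (fderiv ℝ φ y).smulRight (Ω y) :=
      (hdφ.hasFDerivAt.smul hdΩ.hasFDerivAt).fderiv
    have hn : ‖fderiv ℝ (fun y => φ y • Ω y) y‖ ≤ φ y * ‖fderiv ℝ Ω y‖ + ‖fderiv ℝ φ y‖ * ‖Ω y‖ := by
      rw [e]
      refine (norm_add_le _ _).trans (add_le_add ?_ ?_)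
      · rw [norm_smul, Real.norm_of_nonneg (hφ0 y)]
      · exact (ContinuousLinearMap.norm_smulRight_apply _ _).le
    have hop : ‖fderiv ℝ Ω y‖ ^ 2 ≤ frobeniusNormSq (fderiv ℝ Ω y) := sq_opNorm_le_frobeniusNormSq _
    have hop' : φ y ^ 2 * ‖fderiv ℝ Ω y‖ ^ 2 ≤ φ y ^ 2 * frobeniusNormSq (fderiv ℝ Ω y) :=
      mul_le_mul_of_nonneg_left hop (sq_nonneg _)
    have hδ1 : 0 ≤ 1 + δ := by linarith
    calc ‖fderiv ℝ (fun y => φ y • Ω y) y‖ ^ 2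
        ≤ (φ y * ‖fderiv ℝ Ω y‖ + ‖fderiv ℝ φ y‖ * ‖Ω y‖) ^ 2 :=
          pow_le_pow_left₀ (norm_nonneg _) hn 2
      _ ≤ (1 + δ) * (φ y * ‖fderiv ℝ Ω y‖) ^ 2 + (1 + δ⁻¹) * (‖fderiv ℝ φ y‖ * ‖Ω y‖) ^ 2 := add_sq _ _
      _ = (1 + δ) * (φ y ^ 2 * ‖fderiv ℝ Ω y‖ ^ 2) + (1 + δ⁻¹) * (‖fderiv ℝ φ y‖ ^ 2 * ‖Ω y‖ ^ 2) := by ring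
      _ ≤ (1 + δ) * (φ y ^ 2 * frobeniusNormSq (fderiv ℝ Ω y)) + (1 + δ⁻¹) * (‖fderiv ℝ φ y‖ ^ 2 * ‖Ω y‖ ^ 2) := by
          have := mul_le_mul_of_nonneg_left hop' hδ1
          linarith
  have iD : Integrable fun y => φ y ^ 2 * frobeniusNormSq (fderiv ℝ Ω y) :=
    ((hcφ.pow 2).mul hcF).integrable_of_hasCompactSupport hφ2c.mul_right
  have hDφ0 : ∀ y ∉ closedBall (0 : (EuclideanSpace ℝ (Fin 3))) (2 * R), ‖fderiv ℝ φ y‖ ^ 2 = 0 := fun y hy => by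
    rw [hφdef, signedBudget_fderiv_cutoff_eq_zero hR hy, norm_zero]; ring
  have iC : Integrable fun y => ‖fderiv ℝ φ y‖ ^ 2 * ‖Ω y‖ ^ 2 :=
    ((hcDφ.norm.pow 2).mul (hcΩ.norm.pow 2)).integrable_of_hasCompactSupport
      (hcs fun y hy => by show ‖fderiv ℝ φ y‖ ^ 2 * ‖Ω y‖ ^ 2 = 0; rw [hDφ0 y hy, zero_mul])
  have hcollar : (∫ y, ‖fderiv ℝ φ y‖ ^ 2 * ‖Ω y‖ ^ 2) ≤ (c₁ / R) ^ 2 * I := by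
    refine (le_abs_self _).trans (abs_integral_le_of_weight_sq hcΩ (w := fun y => ‖fderiv ℝ φ y‖ ^ 2)
      (hcDφ.norm.pow 2) hDφ0 (fun y _ => ?_) (fun y => ?_))
    · exact pow_le_pow_left₀ (norm_nonneg _) (hc₁ R hR y) 2
    · rw [abs_of_nonneg (by positivity)]
  have hδi : 0 ≤ 1 + δ⁻¹ := by positivity
  have hBle : B ≤ (1 + δ) * D + (1 + δ⁻¹) * ((c₁ / R) ^ 2 * I) := by
    calc B ≤ ∫ y, ((1 + δ) * (φ y ^ 2 * frobeniusNormSq (fderiv ℝ Ω y)) +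
          (1 + δ⁻¹) * (‖fderiv ℝ φ y‖ ^ 2 * ‖Ω y‖ ^ 2)) :=
          integral_mono hiB ((iD.const_mul (1 + δ)).add (iC.const_mul (1 + δ⁻¹))) hDg
      _ = (1 + δ) * D + (1 + δ⁻¹) * ∫ y, ‖fderiv ℝ φ y‖ ^ 2 * ‖Ω y‖ ^ 2 := by
          rw [integral_add (iD.const_mul (1 + δ)) (iC.const_mul (1 + δ⁻¹)), integral_const_mul,
            integral_const_mul]
      _ ≤ (1 + δ) * D + (1 + δ⁻¹) * ((c₁ / R) ^ 2 * I) := by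
          have := mul_le_mul_of_nonneg_left hcollar hδi
          linarith
  -- (6) AM–GM with the weight `η = 2/(1+δ)` and assembly
  have hη : 0 < 2 / (1 + δ) := by positivity
  have hmain := two_mul_le_add_of_le_sqrt_mul_sqrt hCS hP0 hPle hQle (by positivity) hB0 hη
  -- `(2/(1+δ)) B ≤ 2 D + (2/δ)(c₁/R)² I ≤ 2 D + ((2c₁²/δ)/R) I`
  have hR2 : (c₁ / R) ^ 2 ≤ c₁ ^ 2 / R := div_sq_le_sq_div_of_one_le c₁ hR1
  obtain ⟨hcoef, hk⟩ := weight_bookkeeping hδ D ((c₁ / R) ^ 2 * I) (v ^ 2 * KS ^ 2) Zinf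
  have h2δ : 0 ≤ 2 / δ := by positivity
  have hJ : 2 / δ * ((c₁ / R) ^ 2 * I) ≤ 2 / δ * (c₁ ^ 2 / R * I) :=
    mul_le_mul_of_nonneg_left (mul_le_mul_of_nonneg_right hR2 hI0) h2δ
  have hJ' : 2 / δ * (c₁ ^ 2 / R * I) = (2 * c₁ ^ 2 / δ) / R * I := by ring
  have hηB : 2 / (1 + δ) * B ≤ 2 * D + (2 * c₁ ^ 2 / δ) / R * I := by
    have h1 : 2 / (1 + δ) * B ≤ 2 / (1 + δ) * ((1 + δ) * D + (1 + δ⁻¹) * ((c₁ / R) ^ 2 * I)) :=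
      mul_le_mul_of_nonneg_left hBle hη.le
    rw [hcoef] at h1
    rw [← hJ']
    exact h1.trans (by linarith)
  rw [hk] at hmain
  have e6 : (1 + δ) * (v ^ 2 * KS ^ 2) / 6 = (1 + δ) * KS ^ 2 * v ^ 2 / 6 := by ring
  rw [e6] at hmain
  rw [zero_mul, add_zero]
  linarith [hmain, hηB]

end Stretching

end Summit.NavierStokesRegularity.NavierStokesRegularity.Theorems.FiniteDissipationLiouville.VorticityLThree

end
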